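import Literature.AlgebraicGeometry.Resolution.BlowupsIntegral
import Literature.AlgebraicGeometry.Resolution.BlowupsProperProofs
import Literature.AlgebraicGeometry.Resolution.RationalSurfaceSingularitiesBasic
import Literature.AlgebraicGeometry.Resolution.ResolutionGlue
import HarnessLib

/-!
# A resolution factors through a blowing up when the centre pulls back to a Cartier divisor

Topic: `Literature/AlgebraicGeometry/Resolution`. Row F79-F1-iv of the sub-cell «(1.2) 2-reg» of the D-0154 (2)
RES inputs cell (skeleton `F79_2reg_BRICKS_SKELETON.lean`, `stub_factor`): the FORMAL half of Zariski's
factorisation step. For a resolution `π : X → S` of an integral locally Noetherian scheme and the blowing up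
`bl : Y₁ → S` along a non-zero ideal sheaf `I` whose pull-back `I·𝒪_X` is an effective Cartier divisor, the
universal property of blowing up (`IsBlowup.lift`, Görtz–Wedhorn I Def. 13.90 / Prop. 13.91) gives
`ρ : X → Y₁` with `ρ ≫ bl = π`; `ρ` is proper (`π` proper, `bl` separated) and birational (both `π` and `bl`
are). The geometric half — that `𝔪·𝒪_X` IS Cartier for a resolution of a two-dimensional regular local ring
having an exceptional curve (key lemma of quadratic transforms, `QuadraticTransformPrincipal.lean`, at the
closed fibre points; DVRs at the height-one fibre points) — is rows F1-ii/F1-iii and enters here as the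
hypothesis `hcart`.

* `IsResolution.exists_factor_of_isEffectiveCartier_comap` — general `S`;
* `exists_factor_through_blowup_closedPoint_of_isEffectiveCartier` — the skeleton's shape (`S = Spec T`, `T` a
  two-dimensional regular local ring, `I(⊤) = 𝔪_T`), `stub_factor` with its `hne` replaced by `hcart`.

No definitions, no named facts (`Stacks02ND_holds` is a theorem); nothing about (1.2) itself is proved here.

## Sources

* U. Görtz, T. Wedhorn, *Algebraic Geometry I*, 2nd ed. (2020), Def. 13.90, Prop. 13.91 (p. 413–414). [GortzWedhorn2020]
* C. Huneke, I. Swanson, *Integral Closure of Ideals, Rings, and Modules*, CUP 2006, Thm. 14.5.2. [HunekeSwanson2006]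
* The Stacks Project, Tag 02ND, Tag 01RN. [StacksProject]
-/

noncomputable section

open CategoryTheory CategoryTheory.Limits AlgebraicGeometry TopologicalSpace IsLocalRing

namespace Literature.AlgebraicGeometry.Resolution

universe u

/-- Birationality of a factor: if `q : M → Z` and `s ≫ q : Y → Z` are birational, with `Y` and `M`
irreducible, then so is `s` — over `q⁻¹(U₁ ∩ U₂)`, where `U₁`, `U₂ ⊆ Z` are the dense opens over which `s ≫ q`
and `q` are isomorphisms, `s` restricts to (isomorphism) ≫ (isomorphism)⁻¹ (private; the Summits-side
`isBirational_of_comp`, W4.5). [folklore] -/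
private theorem isBirational_of_comp' {Y M Z : Scheme.{u}} [IrreducibleSpace Y] [IrreducibleSpace M]
    {s : Y ⟶ M} {q : M ⟶ Z} (hq : IsBirational q) (h : IsBirational (s ≫ q)) :
    IsBirational s := by
  obtain ⟨U₁, hU₁, -, hiso₁⟩ := h
  obtain ⟨U₂, hU₂, -, hiso₂⟩ := hq
  haveI : Nonempty Z := ⟨q (Classical.arbitrary M)⟩
  have hne : ((U₁ ⊓ U₂ : Z.Opens) : Set Z).Nonempty := by
    rw [Opens.coe_inf, Set.inter_comm]
    exact hU₁.inter_open_nonempty U₂ U₂.2 hU₂.nonempty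
  haveI h₁ : IsIso ((s ≫ q) ∣_ (U₁ ⊓ U₂)) := isIso_morphismRestrict_of_le _ hiso₁ inf_le_left
  haveI h₂ : IsIso (q ∣_ (U₁ ⊓ U₂)) := isIso_morphismRestrict_of_le _ hiso₂ inf_le_right
  obtain ⟨x, hx⟩ := hne
  let y : ↥((s ≫ q) ⁻¹ᵁ (U₁ ⊓ U₂)) :=
    (Scheme.homeoOfIso (asIso ((s ≫ q) ∣_ (U₁ ⊓ U₂)))).symm ⟨x, hx⟩
  have hy : (y : Y) ∈ (s ≫ q) ⁻¹ᵁ (U₁ ⊓ U₂) := y.2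
  refine ⟨q ⁻¹ᵁ (U₁ ⊓ U₂), ?_, ?_, ?_⟩
  · exact (q ⁻¹ᵁ (U₁ ⊓ U₂)).2.dense
      ⟨s y, show q (s y) ∈ U₁ ⊓ U₂ by rw [← Scheme.Hom.comp_apply]; exact hy⟩
  · rw [← Scheme.Hom.comp_preimage]
    exact ((s ≫ q) ⁻¹ᵁ (U₁ ⊓ U₂)).2.dense ⟨y, hy⟩
  · haveI : IsIso (s ∣_ q ⁻¹ᵁ (U₁ ⊓ U₂) ≫ q ∣_ (U₁ ⊓ U₂)) := by
      rw [← morphismRestrict_comp]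
      exact h₁
    exact IsIso.of_isIso_comp_right (s ∣_ q ⁻¹ᵁ (U₁ ⊓ U₂)) (q ∣_ (U₁ ⊓ U₂))

/-- **A resolution factors through the blowing up of a centre that pulls back to a Cartier divisor.** For
`S` integral locally Noetherian, `π : X → S` a resolution, `bl : Y₁ → S` the blowing up along a non-zero ideal
sheaf `I`, and `I·𝒪_X` an effective Cartier divisor: there is `ρ : X → Y₁` with `ρ ≫ bl = π` (universal
property, `IsBlowup.lift`), and `ρ` is proper (cancellation: `π` proper, `bl` separated) and birational (so are
`π` and `bl`, Stacks 02ND). [cite: GortzWedhorn2020, Def. 13.90 and Prop. 13.91 (p. 413–414)] -/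
theorem IsResolution.exists_factor_of_isEffectiveCartier_comap {S X Y₁ : Scheme.{u}} [IsIntegral S]
    [IsLocallyNoetherian S] {π : X ⟶ S} (hπ : IsResolution π) {I : S.IdealSheafData} (hI0 : I ≠ ⊥)
    {bl : Y₁ ⟶ S} (hbl : IsBlowup bl I) (hcart : IsEffectiveCartier (I.comap π)) :
    ∃ ρ : X ⟶ Y₁, ρ ≫ bl = π ∧ IsProper ρ ∧ IsBirational ρ := by
  haveI : IsProper π := hπ.isProper
  haveI : IsProper bl := hbl.isProper
  haveI : IsIntegral X := hπ.isIntegral_source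
  haveI : IsIntegral Y₁ := hbl.isIntegral hI0
  refine ⟨hbl.lift π hcart, hbl.lift_comp π hcart, ?_, ?_⟩
  · haveI : IsProper (hbl.lift π hcart ≫ bl) := by rw [hbl.lift_comp]; infer_instance
    exact IsProper.of_comp _ bl
  · refine isBirational_of_comp' (IsBlowup.isBirational Stacks02ND_holds hbl hI0) ?_
    rw [hbl.lift_comp]
    exact hπ.isBirational

/-- **Zariski's factorisation step, formal half** (skeleton shape): for `T` a two-dimensional regular local
ring, `π : X → Spec T` a resolution, `I` the ideal sheaf of the closed point (`I(⊤) = 𝔪_T`) and `bl : Y₁ → Spec T`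
its blowing up, IF `𝔪_T·𝒪_X = I·𝒪_X` is an effective Cartier divisor then `π = ρ ≫ bl` for a proper birational
`ρ : X → Y₁`. (`𝔪_T ≠ 0` as `dim T = 2`, so `I ≠ 0`; then `IsResolution.exists_factor_of_isEffectiveCartier_comap`.)
The hypothesis holds whenever `π` has an exceptional curve — Huneke–Swanson 14.5.2 at the closed fibre
points (`QuadraticTransformPrincipal.lean`), DVRs at the others — which is rows F1-ii/F1-iii of the cell.
[cite: GortzWedhorn2020, Def. 13.90 and Prop. 13.91 (p. 413–414)] [cite: HunekeSwanson2006, Thm. 14.5.2] -/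
theorem exists_factor_through_blowup_closedPoint_of_isEffectiveCartier {T : Type u} [CommRing T]
    [IsRegularLocalRing T] (hT : ringKrullDim T = 2)
    {X : Scheme.{u}} (π : X ⟶ Spec (.of T)) (hπ : IsResolution π)
    (I : (Spec (.of T)).IdealSheafData)
    (hI : I.ideal ⟨⊤, isAffineOpen_top _⟩ =
      Ideal.map (Scheme.ΓSpecIso (.of T)).inv.hom (maximalIdeal T))
    (hcart : IsEffectiveCartier (I.comap π))
    {Y₁ : Scheme.{u}} (bl : Y₁ ⟶ Spec (.of T)) (hbl : IsBlowup bl I) :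
    ∃ ρ : X ⟶ Y₁, ρ ≫ bl = π ∧ IsProper ρ ∧ IsBirational ρ := by
  haveI := isDomain_of_isRegularLocalRing T
  have hI0 : I ≠ ⊥ := by
    intro h
    have h1 : Ideal.map (Scheme.ΓSpecIso (.of T)).inv.hom (maximalIdeal T) = ⊥ := by
      rw [← hI, h]; rfl
    rw [Ideal.map_eq_bot_iff_of_injective
      (ConcreteCategory.bijective_of_isIso (Scheme.ΓSpecIso (.of T)).inv).1] at h1
    have h0 := ringKrullDim_eq_zero_of_isField ((IsLocalRing.isField_iff_maximalIdeal_eq).mpr h1)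
    rw [hT] at h0
    exact absurd h0 (by decide)
  exact hπ.exists_factor_of_isEffectiveCartier_comap hI0 hbl hcart

end Literature.AlgebraicGeometry.Resolution

end
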